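import Summits.ResolutionOfSingularities.ResolutionOfSingularities.Theorems.RisoStrataRisoCentresResolveHeightOneStep
import Summits.ResolutionOfSingularities.ResolutionOfSingularities.Theorems.RisoStrataRisoCentresResolveHeightOneReach
import Summits.ResolutionOfSingularities.ResolutionOfSingularities.Theorems.RisoStrataRisoCentresResolveHeightOneLU
import Summits.ResolutionOfSingularities.ResolutionOfSingularities.Theorems.RisoStrataRisoCentresResolvePersist

/-!
# Route RisoStrata — crux `RisoCentresResolve` (stmt-ResolutionOfSingularities-18546), line `Sketch`, cycle 3:
# stub `stub_rcrLazyHeightOne` (any word with infinitely many top letters uniformizes one-dimensional centres)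

This is the "lazy" generalisation of `stub_rcrHeightOneLU`
(`RisoStrataRisoCentresResolveHeightOneLU.lean`) from the constant top word `w ≡ N` to an
ARBITRARY word `w : ℕ → ℕ` with infinitely many letters `≥ N` (top letters), for a cut predicate
`P` that is only known to hold at every maximal ideal at the levels `d ≥ N`.

Setting: `k` algebraically closed, `K = k(hᵢ/hⱼ)` a projective presentation by `N + 1` nonzero
elements (any transcendence degree), `O ⊇ k` a valuation ring of `K` containing the chart
`B₀ = k[hᵢ/hⱼ₀]`, whose local ring at the centre of `O` has Krull dimension `≤ 1`. Conclusion: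
some everywhere-admissible chart path of the `w`-tower starting at `B₀` reaches a regular local
ring at the centre of `O` after finitely many steps.

Proof (`lazyHeightOne_tower`, generic in `P`, `N`, `w`):
* `O = ⊤`: stage `0` is already regular (`curveAssembly_regular_top`).
* `O ≠ ⊤`: build the recursive everywhere-admissible tower `T 0 = B₀`,
  `T (t+1) = (T t)[Cen(T t, w t)/x_t]` (`rcr_exists_risoValid`; the letter `w t` depends on the
  stage index, so the recursion threads `t`); its stages are the riso stages along `w`
  (`risoStage_succ`, `reduction_getD_map_range`). The local rings `A t = risoLoc O (T t)` have
  Krull dimension `≤ 1` throughout (`heightOneLU_ringKrullDim_le`, Krull–Akizuki).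
* DICHOTOMY at stage `t` (`lazyHeightOne_risoLoc_risoStep_eq`): either the centre ideal
  `Cen(T t, w t)` contains a unit of `O` — then admissibility makes `x_t` a unit of `O` and
  `T t ⊆ T (t+1) ⊆ A t`, so `A (t+1) = A t` (the step is lazy) — or it lies in the centre of `O`
  (an "acting" time) — then, while `A t` is singular, `A (t+1)` is the quadratic transform of
  `A t` along `O` (`stub_rcrHeightOneStep`). At a top time with singular `A t` the second case
  holds (`heightOneLU_valuation_lt_one`, which only needs `P` at the level `w t ≥ N`).
* If no `A t` were regular, the acting times would form an infinite set (it contains all top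
  times, `hw`); enumerating it increasingly by `Nat.nth` and using laziness in between, the
  subsequence `n ↦ A (nth n)` is an infinite sequence of quadratic transforms along `O` starting at
  `A 0 = B₀_{𝔪_O ∩ B₀}`, which reaches `O`, a discrete valuation ring (`stub_rcrHeightOneReach`) —
  a regular local ring: contradiction.
-/

noncomputable section

set_option linter.dupNamespace false -- mandated namespace of this single-conjunct summit

namespace Summit.ResolutionOfSingularities.ResolutionOfSingularities.Theorems

open Summit.ResolutionOfSingularities.ResolutionOfSingularities.Theses.RisoStrata
open Literature.AlgebraicGeometry.Resolution IsLocalRing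

/-! ## Generic ingredients (any cut predicate `P`, any word `w`) -/

section Generic

variable {k K : Type} [Field k] [Field K] [Algebra k K]

/-- **Lazy steps.** If the centre ideal `Cen(B,d)` of a chart `B ⊆ O` is NOT inside the centre
of `O` (some element of it has value `1`, i.e. is a unit of `O`), then an admissible step does not
change the local ring at the centre of `O`: admissibility (`a · x⁻¹ ∈ O` for the unit `a`) makes
the denominator `x ∈ B` a unit of `O`, so `B ⊆ B[Cen/x] ⊆ B_{𝔪_O ∩ B}` and the sandwich rule
`risoLoc_eq_of_le_of_le` applies. [folklore] -/
theorem lazyHeightOne_risoLoc_risoStep_eq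
    (P : ∀ B : Subalgebra k K, Ideal ↥B → ℕ → Prop) {O : ValuationSubring K}
    {B : Subalgebra k K} (hBO : B.toSubring ≤ O.toSubring) {d : ℕ} {xt : K}
    (hV : risoValid P O B d xt)
    (hCen : ¬ ∀ a ∈ risoCen P B d, O.valuation ((a : ↥B) : K) < 1) :
    risoLoc O (risoStep P B d xt) = risoLoc O B := by
  push Not at hCen
  obtain ⟨a, haCen, hva⟩ := hCen
  have hva1 : O.valuation ((a : ↥B) : K) = 1 :=
    le_antisymm ((O.valuation_le_one_iff _).mpr (hBO a.2)) hva
  obtain ⟨-, ⟨x₀, -, hx₀⟩, hadm⟩ := hV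
  have hxtO : xt⁻¹ ∈ O := persist_inv_mem_of_mul_inv_mem hva1 (hadm a haCen)
  have hxtB : xt ∈ B := hx₀ ▸ x₀.2
  exact risoLoc_eq_of_le_of_le hBO (le_risoStep P B d xt) (risoStep_le_risoLoc O hxtB hxtO)

/-- **The everywhere-admissible tower along a word with infinitely many top letters reaches a
regular local ring** (non-trivial valuation ring `O` with one-dimensional centre on the finitely
generated `B₀ ⊆ O`, `Frac B₀ = K`; cut predicate `P` holding at every maximal ideal for every
letter `≥ N`). Choose an admissible denominator for every finitely generated chart inside `O` and
every letter, and iterate the riso step from `B₀` along `w`; the stages of the `w`-tower are these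
iterates. Their local rings at the centre of `O` have dimension `≤ 1`
(`heightOneLU_ringKrullDim_le`); a step either fixes the local ring (centre ideal not inside the
centre of `O`, `lazyHeightOne_risoLoc_risoStep_eq`) or, while singular, is a quadratic transform
along `O` (`stub_rcrHeightOneStep`), the latter at every top letter
(`heightOneLU_valuation_lt_one`). Were no stage regular, the local rings at the (infinitely many,
`Nat.nth`-enumerated) acting times would form an infinite sequence of quadratic transforms along
`O`, which reaches the discrete valuation ring `O` (`stub_rcrHeightOneReach`) — regular:
contradiction. [folklore] -/
theorem lazyHeightOne_tower [IsAlgClosed k]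
    (P : ∀ B : Subalgebra k K, Ideal ↥B → ℕ → Prop) (N : ℕ)
    (hP : ∀ (B : Subalgebra k K) (m : Ideal ↥B), m.IsMaximal → ∀ d : ℕ, N ≤ d → P B m d)
    (w : ℕ → ℕ) (hw : ∀ n : ℕ, ∃ t, n ≤ t ∧ N ≤ w t)
    (B₀ : Subalgebra k K) (hB₀ : B₀.FG)
    (hfrac : ∀ z : K, ∃ a ∈ B₀, ∃ b ∈ B₀, b ≠ 0 ∧ z = a / b)
    (O : ValuationSubring K) (hB₀O : B₀.toSubring ≤ O.toSubring) (hO : O ≠ ⊤)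
    (hdim : ringKrullDim ↥(risoLoc O B₀) ≤ 1) :
    ∃ (x : ℕ → K) (t : ℕ),
      (∀ s, s < t → risoValid P O (risoStage P B₀ ((List.range t).map w) x s) (w s) (x s)) ∧
      IsRegularLocalRing ↥(risoLoc O (risoStage P B₀ ((List.range t).map w) x t)) := by
  classical
  -- an admissible denominator for every finitely generated chart inside `O` and every letter
  have hsel : ∀ (B : Subalgebra k K) (d : ℕ), ∃ xt : K,
      B.FG → B.toSubring ≤ O.toSubring → risoValid P O B d xt := by
    intro B d
    by_cases hB : B.FG ∧ B.toSubring ≤ O.toSubring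
    · obtain ⟨xt, hxt⟩ := rcr_exists_risoValid P O B hB.1 hB.2 d
      exact ⟨xt, fun _ _ => hxt⟩
    · exact ⟨0, fun h1 h2 => absurd ⟨h1, h2⟩ hB⟩
  choose xsel hxsel using hsel
  -- the recursive tower `T 0 = B₀`, `T (t+1) = (T t)[Cen(T t, w t)/xsel (T t) (w t)]`
  obtain ⟨T, hT0, hTs⟩ : ∃ T : ℕ → Subalgebra k K,
      T 0 = B₀ ∧ ∀ t, T (t + 1) = risoStep P (T t) (w t) (xsel (T t) (w t)) :=
    ⟨fun t => Nat.rec (motive := fun _ => Subalgebra k K) B₀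
      (fun s B => risoStep P B (w s) (xsel B (w s))) t, rfl, fun _ => rfl⟩
  have hinv : ∀ t, (T t).FG ∧ (T t).toSubring ≤ O.toSubring := by
    intro t
    induction t with
    | zero => rw [hT0]; exact ⟨hB₀, hB₀O⟩
    | succ t ih =>
      rw [hTs t]
      exact ⟨risoStep_fg ih.1 _ _, risoStep_toSubring_le ih.2 (hxsel _ _ ih.1 ih.2)⟩
  have hle0 : ∀ t, B₀ ≤ T t := by
    intro t
    induction t with
    | zero => rw [hT0]
    | succ t ih => rw [hTs t]; exact ih.trans (le_risoStep P _ _ _)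
  obtain ⟨x, hx⟩ : ∃ x : ℕ → K, ∀ t, x t = xsel (T t) (w t) := ⟨_, fun _ => rfl⟩
  have hval : ∀ t, risoValid P O (T t) (w t) (x t) := fun t => by
    rw [hx]; exact hxsel (T t) (w t) (hinv t).1 (hinv t).2
  have hTs' : ∀ t, T (t + 1) = risoStep P (T t) (w t) (x t) := fun t => by rw [hTs t, hx t]
  -- the stages along `w` with denominators `x` are the `T s`
  have hstage : ∀ t s, s ≤ t → risoStage P B₀ ((List.range t).map w) x s = T s := by
    intro t s
    induction s with
    | zero => intro; rw [risoStage_zero, hT0]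
    | succ s ih =>
      intro hs
      have hs' : s < ((List.range t).map w).length := by
        rw [List.length_map, List.length_range]; exact hs
      rw [risoStage_succ P B₀ _ x hs', ih (Nat.le_of_succ_le hs),
        reduction_getD_map_range w (show s < t from hs), hTs' s]
  -- dimension `≤ 1` persists along the tower
  have hdimT : ∀ t, ringKrullDim ↥(risoLoc O (T t)) ≤ 1 := fun t =>
    heightOneLU_ringKrullDim_le hB₀ hfrac hB₀O hO hdim (hle0 t)
  -- some `T t` has a regular local ring at the centre of `O`
  have hex : ∃ t, IsRegularLocalRing ↥(risoLoc O (T t)) := by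
    by_contra hall
    push Not at hall
    -- the acting times: the centre ideal lies inside the centre of `O`
    obtain ⟨S, hS⟩ : ∃ S : ℕ → Prop,
        ∀ t, S t ↔ ∀ a ∈ risoCen P (T t) (w t), O.valuation ((a : ↥(T t)) : K) < 1 :=
      ⟨_, fun _ => Iff.rfl⟩
    -- top times act (the local ring being singular)
    have htop : ∀ t, N ≤ w t → S t := fun t hNt =>
      (hS t).mpr (heightOneLU_valuation_lt_one P (hinv t).1 (hinv t).2 (w t)
        (fun m hm => hP (T t) m hm (w t) hNt) (hall t))
    -- non-acting times are lazy
    have hlazy : ∀ t, ¬ S t → risoLoc O (T (t + 1)) = risoLoc O (T t) := fun t ht => by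
      rw [hTs' t]
      exact lazyHeightOne_risoLoc_risoStep_eq P (hinv t).2 (hval t) fun h => ht ((hS t).mpr h)
    -- acting times transform quadratically
    have hact : ∀ t, S t → IsQuadraticTransformAlong O (risoLoc O (T t)).toSubring
        (risoLoc O (T (t + 1))).toSubring := fun t ht => by
      rw [hTs' t]
      exact stub_rcrHeightOneStep P (w t) (T t) (hinv t).1 O (hinv t).2 (hdimT t) (hall t)
        ((hS t).mp ht) (x t) (hval t)
    -- the local ring is constant across intervals without acting times
    have hconst : ∀ a b, a ≤ b → (∀ m, a ≤ m → m < b → ¬ S m) →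
        risoLoc O (T b) = risoLoc O (T a) := by
      intro a b hab
      induction b, hab using Nat.le_induction with
      | base => intro; rfl
      | succ b hab ih =>
        intro hm
        rw [hlazy b (hm b hab (Nat.lt_succ_self b))]
        exact ih fun m h1 h2 => hm m h1 (h2.trans (Nat.lt_succ_self b))
    -- the acting times form an infinite set; enumerate it increasingly
    have hSinf : (setOf S).Infinite := by
      refine Nat.frequently_atTop_iff_infinite.mp (Filter.frequently_atTop.mpr fun n => ?_)
      obtain ⟨t, hnt, hNt⟩ := hw n
      exact ⟨t, hnt, htop t hNt⟩
    obtain ⟨σ, hσS, hσ0, hσgap, hσlt⟩ : ∃ σ : ℕ → ℕ, (∀ n, S (σ n)) ∧ (∀ m, m < σ 0 → ¬ S m) ∧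
        (∀ n m, σ n < m → m < σ (n + 1) → ¬ S m) ∧ ∀ n, σ n < σ (n + 1) := by
      refine ⟨Nat.nth S, Nat.nth_mem_of_infinite hSinf, fun m hm => ?_,
        fun n m h1 h2 hm => Nat.not_lt.mpr (Nat.le_nth_of_lt_nth_succ h2 hm) h1,
        fun n => Nat.nth_strictMono hSinf (Nat.lt_succ_self n)⟩
      rw [Nat.nth_zero] at hm
      exact Nat.notMem_of_lt_sInf hm
    -- the quadratic subsequence of local rings at the acting times
    obtain ⟨A, hA⟩ : ∃ A : ℕ → Subring K, ∀ n, A n = (risoLoc O (T (σ n))).toSubring :=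
      ⟨_, fun _ => rfl⟩
    have hA0 : A 0 = locAtCentre B₀.toSubring O := by
      rw [hA, hconst 0 (σ 0) (Nat.zero_le _) (fun m _ hm => hσ0 m hm), hT0]
      exact risoLoc_toSubring_eq hB₀O
    have hAstep : ∀ n, IsQuadraticTransformAlong O (A n) (A (n + 1)) := fun n => by
      rw [hA, hA, hconst (σ n + 1) (σ (n + 1)) (Nat.succ_le_of_lt (hσlt n))
        (fun m h1 h2 => hσgap n m h1 h2)]
      exact hact (σ n) (hσS n)
    have hdim' : ringKrullDim ↥(locAtCentre B₀.toSubring O) ≤ 1 := by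
      rw [heightOneLU_ringKrullDim_locAtCentre hB₀O]; exact hdim
    obtain ⟨hdvr, c, hc⟩ := stub_rcrHeightOneReach B₀ hB₀ hfrac O hB₀O hO hdim' A hA0 hAstep
    rw [hA] at hc
    haveI : IsDiscreteValuationRing ↥O := hdvr
    have hmemc : ∀ y : K, y ∈ risoLoc O (T (σ c)) ↔ y ∈ O := fun y => SetLike.ext_iff.mp hc y
    let e : ↥(risoLoc O (T (σ c))) ≃+* ↥O :=
      { toFun := fun y => ⟨y.1, (hmemc y.1).mp y.2⟩
        invFun := fun y => ⟨y.1, (hmemc y.1).mpr y.2⟩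
        left_inv := fun _ => rfl
        right_inv := fun _ => rfl
        map_mul' := fun _ _ => rfl
        map_add' := fun _ _ => rfl }
    exact hall (σ c) (IsRegularLocalRing.of_ringEquiv e.symm)
  obtain ⟨t, ht⟩ := hex
  refine ⟨x, t, fun s hs => ?_, ?_⟩
  · rw [hstage t s hs.le]; exact hval s
  · rw [hstage t t le_rfl]; exact ht

end Generic

/-! ## The stub -/

/-- **Stub (lazy height-one uniformization; provable).** Along ANY word with infinitely many
letters `≥ N` (top letters), a valuation ring `O ⊇ k` whose centre on a chart `k[hᵢ/hⱼ₀] ⊆ O` has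
a local ring of Krull dimension `≤ 1` is uniformized after finitely many admissible riso steps:
at each letter the local ring at the centre either stays (the centre ideal is not inside the
centre of `O`: the chart is a localisation at an `O`-unit) or becomes its quadratic transform along
`O` (`stub_rcrHeightOneStep`); at a top letter with singular centre it transforms
(`heightOneLU_valuation_lt_one`); an everywhere-singular tower would contain an infinite quadratic
sequence, which reaches the regular `O` (`stub_rcrHeightOneReach`). The cut predicate is only
needed at levels `≥ N`. -/
theorem stub_rcrLazyHeightOne {k K : Type} [Field k] [IsAlgClosed k] [Field K] [Algebra k K]
    (P : ∀ B : Subalgebra k K, Ideal ↥B → ℕ → Prop) (N : ℕ)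
    (hP : ∀ (B : Subalgebra k K) (m : Ideal ↥B), m.IsMaximal → ∀ d : ℕ, N ≤ d → P B m d)
    (w : ℕ → ℕ) (hw : ∀ n : ℕ, ∃ t, n ≤ t ∧ N ≤ w t)
    (h : Fin (N + 1) → K) (hh : ∀ i, h i ≠ 0)
    (hgen : IntermediateField.adjoin k
      (Set.range fun ij : Fin (N + 1) × Fin (N + 1) => h ij.1 * (h ij.2)⁻¹) = ⊤)
    (O : ValuationSubring K) (hk : ∀ c : k, algebraMap k K c ∈ O)
    (j₀ : Fin (N + 1)) (hj₀ : ∀ i, h i * (h j₀)⁻¹ ∈ O)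
    (hdim : ringKrullDim ↥(risoLoc O (Algebra.adjoin k (Set.range fun i => h i * (h j₀)⁻¹))) ≤ 1) :
    ∃ (j : Fin (N + 1)) (x : ℕ → K) (t : ℕ), (∀ i, h i * (h j)⁻¹ ∈ O) ∧
      (∀ s, s < t → risoValid P O (risoStage P (Algebra.adjoin k (Set.range fun i => h i * (h j)⁻¹))
        ((List.range t).map w) x s) (w s) (x s)) ∧
      IsRegularLocalRing ↥(risoLoc O (risoStage P
        (Algebra.adjoin k (Set.range fun i => h i * (h j)⁻¹)) ((List.range t).map w) x t)) := by
  have hB₀O := chart_toSubring_le hk h j₀ hj₀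
  by_cases hO : O = ⊤
  · subst hO
    exact ⟨j₀, fun _ => 0, 0, hj₀, fun s hs => absurd hs (Nat.not_lt_zero s),
      curveAssembly_regular_top _⟩
  · obtain ⟨x, t, hV, hreg⟩ := lazyHeightOne_tower P N hP w hw _
      (curveAssembly_chart_fg h j₀) (curveAssembly_frac h hh hgen j₀) O hB₀O hO hdim
    exact ⟨j₀, x, t, hj₀, hV, hreg⟩

end Summit.ResolutionOfSingularities.ResolutionOfSingularities.Theorems

end
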